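import Summits.BirchSwinnertonDyer.BirchSwinnertonDyer.Theorems.EisensteinPrimesAcTwistDeformationCurveFullAtShapiro
import Summits.BirchSwinnertonDyer.BirchSwinnertonDyer.Theorems.EisensteinPrimesAcTwistDeformationCurveFullAtAlmostDivisible
import Summits.BirchSwinnertonDyer.BirchSwinnertonDyer.Theorems.EisensteinPrimesXAcImprimitiveNoPTorsion
import Summits.BirchSwinnertonDyer.BirchSwinnertonDyer.Theorems.EisensteinPrimesXAcImprimitiveLambdaShift
import Summits.BirchSwinnertonDyer.BirchSwinnertonDyer.Theorems.UniversalToricDescentAcDualMuZeroCriterion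
import HarnessLib

/-!
# (N1)^∅: Castella's PRIMITIVE dual `X_ac(E/K_∞) = XAc E_K p κ v̄ ∅ γ` (CGLS's `𝔛_E`) HAS NO `p`-TORSION, modulo Greenberg's published facts
# by name — at every reduction type given its cotorsion, and at a NON-SPLIT multiplicative Eisenstein prime modulo CGLS22 Prop. 14
# (cell `bsd-eis`, width seat `bsd-line-x2-p2` gen 7; helper for stmt-BirchSwinnertonDyer-19034; primitive twin of p654300 / p654696,
# assembling p654845 `…CurveFullAtAlmostDivisible` and `…CurveFullAtShapiro`)

HONEST FRAMING (cell `bsd-eis`, run/shared/lean/pub/bsd-eis/): bookkeeping; no definition, no named fact introduced, no `sorry`, no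
`Theses` import; nothing about BSD or a main conjecture is asserted; nothing booked; no label or count moves. Helper `--supports
stmt-BirchSwinnertonDyer-19034`; closes no stub. CONDITIONAL BY NAME on Greenberg 2016 Prop. 4.1.1 + Greenberg 2006 Props. 4.1, 4.2, 3.2
[PUB]; §2 also on CGLS22 Prop. 14's finiteness clause (`prop14_residualCharacterSelmer_finite`) [PUB].

## What

* §1 **`xAc_empty_smul_eq_zero_imp_of_facts`** — `E = W/ℚ` over the imaginary quadratic `K` ((Heeg) for `N_E`), `2 < p = v v̄`, `κ`
  anticyclotomic with generator `γ`, `Sf` the places over `N_E` off `p` (only used to build the arena `S = {v, v̄} ∪ Sf`): if `X_ac(E/K_∞)`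
  is finitely generated, `Λ`-torsion, `μ = 0`, then `∀ x : XAc E_K p κ v̄ ∅ γ, p • x = 0 → x = 0`, GRANTED the four Greenberg facts by
  name; ANY reduction type at `p` (so also the x1 cell's good ordinary Eisenstein primes: CGLS22 Cor. 1.4.3's «𝔛_E has no non-zero
  finite `Λ`-submodule» for the strict/Greenberg Selmer group, modulo PUB + cotorsion). Chain: x1-w3 g3's `hasCorank_fullAtSelmer_zero_of_xAc`,
  p654845 `primaryTorsion_fullAtSelmer_isAlmostDivisible`, `exists_addMonoidHom_fullAtSelmer_bijective`, `xAc_eq_zero_of_smul_eq_zero_of_bijective`.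
  `xAc_empty_smul_eq_zero_imp_of_facts_of_pTorsion_finite`: the same from `Sel_{v̄}(K_∞, E_K[p^∞])[p]` finite (bsd-wall's UTD criterion).
* §2 **`xAc_empty_smul_eq_zero_imp_of_facts_of_not_split`** — at a NON-SPLIT multiplicative Eisenstein datum (`Mult`, `¬` split, `Red`)
  modulo the Greenberg facts + CGLS22 Prop. 14: cotorsion / `μ = 0` of `X^{Sf}` (g4's p626493) descends to the quotient `X^∅`
  (k5-c2 g11's `XAcImprimitiveLambdaShift`, `∅ ⊆ ↑Sf`).

References: [Greenberg2016Selmer] Prop. 4.1.1 (c); [Greenberg2006] Thm. 3, Props. 3.2, 4.1, 4.2, §5 A; [CastellaGrossiLeeSkinner2022] §1.2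
Prop. 14, §1.4 Cor. 1.4.3, §2.3 (`𝔛_E`); [KellerYin2024] Thm. 1.4.1, §1.4 (e) (arXiv:2402.12781v2); [Castella2018] Def. 2.2; [PollackWeston2011]
App. A Prop. A.2.
-/

set_option autoImplicit false
set_option linter.dupNamespace false -- the summit namespace `…BirchSwinnertonDyer.BirchSwinnertonDyer.Theorems` (Sub = Summit, D-0017) trips it

noncomputable section

open scoped Classical
open NumberField IsDedekindDomain Field Multiplicative PowerSeries WeierstrassCurve
open Literature.NumberTheory.EllipticCurves Literature.NumberTheory.EllipticCurves.GreenbergSelmer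
  Literature.NumberTheory.EllipticCurves.GreenbergVatsal2000 Literature.NumberTheory.GaloisRepresentations
  Literature.NumberTheory.EllipticCurves.KellerYin2024 Literature.NumberTheory.EllipticCurves.IwasawaDual
  Literature.NumberTheory.EllipticCurves.Castella2018.AcSelmer Literature.NumberTheory.EllipticCurves.Rank1Residual
  Literature.NumberTheory.EllipticCurves.CastellaGrossiLeeSkinner2022
  Literature.NumberTheory.IwasawaTheory Literature.NumberTheory.IwasawaTheory.Greenberg2016
  Literature.NumberTheory.IwasawaTheory.Greenberg2006
  Summit.BirchSwinnertonDyer.BirchSwinnertonDyer.Theorems.GreenbergFullAtSelmer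
  Summit.BirchSwinnertonDyer.BirchSwinnertonDyer.Theorems.AcTwistDeformationResidualPair
  Summit.BirchSwinnertonDyer.BirchSwinnertonDyer.Theorems.AcTwistDeformation
  Summit.BirchSwinnertonDyer.BirchSwinnertonDyer.Theorems

namespace Summit.BirchSwinnertonDyer.BirchSwinnertonDyer.Theorems.XAcImprimitiveNoPTorsion

variable {K : Type} [Field K] [NumberField K] {p : ℕ} [Fact p.Prime]

/-! ## §1 No `p`-torsion in the primitive `X_ac(E/K_∞)`, modulo Greenberg's facts by name (any reduction type) -/

/-- **(N1)^∅ — the PRIMITIVE dual `XAc E_K p κ v̄ ∅ γ` HAS NO `p`-TORSION** (no non-zero finite `Λ`-submodule), for `E = W/ℚ` over the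
imaginary quadratic `K` with the Heegner hypothesis for `N_E`, `2 < p = v v̄` split, `κ` anticyclotomic with topological generator `γ`,
`Sf` the places over `N_E` off `p`, and `X_ac(E/K_∞)` finitely generated, `Λ`-torsion, `μ = 0`; GRANTED Greenberg 2016 Prop. 4.1.1 and
Greenberg 2006 Props. 4.1, 4.2, 3.2 BY NAME. Any reduction type at `p`. [cite: Greenberg2016Selmer, Prop. 4.1.1 (c) (§4.1 p. 15 L21–32), §4.3 pp. 20–21]
[cite: Greenberg2006, Thm. 3, Props. 3.2, 4.1, 4.2, §5 A] [cite: CastellaGrossiLeeSkinner2022, Cor. 1.4.3, §2.3]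
[cite: PollackWeston2011, App. A Prop. A.2] -/
theorem xAc_empty_smul_eq_zero_imp_of_facts (h411 : prop411_selmer_isAlmostDivisible)
    (h41 : prop41_globalEulerPoincareCorank) (h42 : prop42_localEulerPoincareCorank)
    (h32 : prop32_cohomology_isCofinitelyGenerated)
    (W : WeierstrassCurve ℚ) [W.IsElliptic] (hp : 2 < p) (hK : IsImaginaryQuadratic K)
    (hH : SatisfiesHeegnerHypothesis (W.conductorNorm ℤ) K)
    {v vbar : HeightOneSpectrum (𝓞 K)} (hv : ((p : ℕ) : 𝓞 K) ∈ v.asIdeal)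
    (hvbar : ((p : ℕ) : 𝓞 K) ∈ vbar.asIdeal) (hne : vbar ≠ v)
    (κ : ZpExtension K p) (hκ : κ.IsAnticyclotomic) (γ : absoluteGaloisGroup K) [Fact (κ.IsTopGenerator γ)]
    (Sf : Finset (HeightOneSpectrum (𝓞 K)))
    (hSf : ∀ w : HeightOneSpectrum (𝓞 K), w ∈ Sf ↔
      (((W.conductorNorm ℤ : ℤ) : 𝓞 K) ∈ w.asIdeal ∧ ((p : ℕ) : 𝓞 K) ∉ w.asIdeal))
    (hXfin : Module.Finite (IwasawaAlgebra p) (XAc (W.baseChange K) p κ vbar (∅ : Set (HeightOneSpectrum (𝓞 K))) γ))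
    (hXtor : Module.IsTorsion (IwasawaAlgebra p) (XAc (W.baseChange K) p κ vbar (∅ : Set (HeightOneSpectrum (𝓞 K))) γ))
    (hμ : muInvariant p (XAc (W.baseChange K) p κ vbar (∅ : Set (HeightOneSpectrum (𝓞 K))) γ) = 0)
    (x : XAc (W.baseChange K) p κ vbar (∅ : Set (HeightOneSpectrum (𝓞 K))) γ) (hx : p • x = 0) : x = 0 := by
  haveI hEK : (W.baseChange K).IsElliptic := inferInstanceAs (W.map (algebraMap ℚ K)).IsElliptic
  -- the arena `S = {v, v̄} ∪ Sf`
  set S : Set (HeightOneSpectrum (𝓞 K)) := (↑(insert v (insert vbar Sf)) : Set (HeightOneSpectrum (𝓞 K))) with hSdef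
  have hS : ∀ w : HeightOneSpectrum (𝓞 K), ((p : ℕ) : 𝓞 K) ∈ w.asIdeal → w ∈ S :=
    mem_insert_insert_of_natCast_mem hK hv hvbar hne Sf
  have hSfS : ∀ w ∈ Sf, w ∈ S := fun w hw ↦ by
    rw [hSdef, Finset.coe_insert, Finset.coe_insert]
    exact Or.inr (Or.inr (Finset.mem_coe.mpr hw))
  have hSp : ∀ w : HeightOneSpectrum (𝓞 K), w ∈ S → ((p : ℕ) : 𝓞 K) ∈ w.asIdeal → w = v ∨ w = vbar :=
    fun w _ hw ↦ eq_or_eq_of_natCast_mem_of_ne hK.1 hv hvbar hne hw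
  have hgoodN : ∀ w : HeightOneSpectrum (𝓞 K), ((W.conductorNorm ℤ : ℤ) : 𝓞 K) ∉ w.asIdeal →
      (W.baseChange K).HasGoodReductionAt w := fun w hw ↦
    EisensteinPrimesMuLambda.hasGoodReductionAt_baseChange_of_conductorNorm_notMem W w hw
  have hSbad : ∀ w : HeightOneSpectrum (𝓞 K), ¬ (W.baseChange K).HasGoodReductionAt w → w ∈ S := by
    intro w hw
    have hN : ((W.conductorNorm ℤ : ℤ) : 𝓞 K) ∈ w.asIdeal := by_contra fun h ↦ hw (hgoodN w h)
    by_cases hpw : ((p : ℕ) : 𝓞 K) ∈ w.asIdeal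
    · exact hS w hpw
    · exact hSfS w ((hSf w).mpr ⟨hN, hpw⟩)
  have hgood : ∀ w : HeightOneSpectrum (𝓞 K), w ∉ S → ((p : ℕ) : 𝓞 K) ∉ w.asIdeal →
      (W.baseChange K).HasGoodReductionAt w := fun w hw _ ↦ by_contra fun h ↦ hw (hSbad w h)
  -- the model `ρ₀`
  have hNS : ∀ n ∈ ramificationSubgroup K S, ∀ P : PrimaryTorsion (W.baseChange K).geomPoints p, n • P = P :=
    fun n hn P ↦ SignedBaseChangeAcDivCurveModel.smul_primaryTorsion_eq_of_mem_ramificationSubgroup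
      (W.baseChange K) p S hSbad hS hn P
  obtain ⟨ρ₀, hρ₀⟩ := SignedBaseChangeAcDivCurveModel.exists_continuousRep_primaryTorsion (W.baseChange K) p S hNS
  letI tΛ : TopologicalSpace (PowerSeries ℤ_[p]) := ⊥
  haveI : DiscreteTopology (PowerSeries ℤ_[p]) := ⟨rfl⟩
  haveI : IsTopologicalRing (PowerSeries ℤ_[p]) := inferInstance
  haveI : IsTopologicalAddGroup (BigRepModule ℤ_[p] p (PrimaryTorsion (W.baseChange K).geomPoints p)) :=
    inferInstance
  haveI : ContinuousSMul (PowerSeries ℤ_[p]) (BigRepModule ℤ_[p] p (PrimaryTorsion (W.baseChange K).geomPoints p)) :=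
    inferInstance
  haveI := hK.2
  have hKc : ∀ w : InfinitePlace K, w.IsComplex := IsTotallyComplex.isComplex
  have hsup : ∀ w : HeightOneSpectrum (𝓞 K), w ∈ S →
      ∃ σ : absoluteGaloisGroup (Place.Completion (Sum.inr w : Place K)), κ (absGaloisRestrict K _ σ) ≠ 1 := by
    intro w hw
    refine exists_local_apply_ne_one_of_mem_or hK hp hH κ hκ w ?_
    rw [hSdef, Finset.coe_insert, Finset.coe_insert] at hw
    rcases hw with rfl | rfl | hw
    · exact Or.inl hv
    · exact Or.inl hvbar
    · exact Or.inr ((hSf w).mp (Finset.mem_coe.mp hw)).1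
  -- the Shapiro descent with `ψ = id`
  let ψ : PrimaryTorsion (W.baseChange K).geomPoints p ≃+ (W.baseChange K).geomPrimaryTorsion p := AddEquiv.refl _
  have hψ : ∀ (σ : absoluteGaloisGroup K) (a : PrimaryTorsion (W.baseChange K).geomPoints p),
      ψ (ρ₀ (toUnramifiedQuot K S σ) a) = σ • ψ a := fun σ a ↦ by rw [hρ₀]; rfl
  obtain ⟨F, hF⟩ := exists_shapiroDescent S hS κ ρ₀ ψ hψ
  -- corank `0` (x1-w3 g3), Prop. 4.1.1 (c), the bijection, duality
  obtain ⟨hSel, -⟩ := hasCorank_fullAtSelmer_zero_of_xAc S (W.baseChange K) hS κ ρ₀ hρ₀ hKc hv hvbar hne hgood hXfin hXtor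
  have hAD := primaryTorsion_fullAtSelmer_isAlmostDivisible (W.baseChange K) hS κ ρ₀ h411 h41 h42 h32
    (Finset.finite_toSet _) hK hsup hne hv hvbar hSel
  obtain ⟨φ, hφbij, -, hφ⟩ := exists_addMonoidHom_fullAtSelmer_bijective S (W.baseChange K) hS κ ρ₀ hρ₀ hKc hv hvbar hne hSp
    hgood hF (γ := γ)
  exact xAc_eq_zero_of_smul_eq_zero_of_bijective S (W.baseChange K) hS κ ρ₀ vbar (∅ : Set (HeightOneSpectrum (𝓞 K))) _ φ
    hφbij hφ hAD hXfin hXtor hμ x hx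

/-- **(N1)^∅ from the finiteness of `Sel_{v̄}(K_∞, E_K[p^∞])[p]`** (any reduction type): binders of `xAc_empty_smul_eq_zero_imp_of_facts`;
finite generation is Castella's (`XAc.module_finite_empty`), torsion and `μ = 0` are bsd-wall's UTD criterion.
[cite: Greenberg2016Selmer, Prop. 4.1.1 (c)] [cite: Greenberg2006, Props. 3.2, 4.1, 4.2] [cite: GreenbergLNM1716, §1 p. 60] -/
theorem xAc_empty_smul_eq_zero_imp_of_facts_of_pTorsion_finite (h411 : prop411_selmer_isAlmostDivisible)
    (h41 : prop41_globalEulerPoincareCorank) (h42 : prop42_localEulerPoincareCorank)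
    (h32 : prop32_cohomology_isCofinitelyGenerated)
    (W : WeierstrassCurve ℚ) [W.IsElliptic] (hp : 2 < p) (hK : IsImaginaryQuadratic K)
    (hH : SatisfiesHeegnerHypothesis (W.conductorNorm ℤ) K)
    {v vbar : HeightOneSpectrum (𝓞 K)} (hv : ((p : ℕ) : 𝓞 K) ∈ v.asIdeal)
    (hvbar : ((p : ℕ) : 𝓞 K) ∈ vbar.asIdeal) (hne : vbar ≠ v)
    (κ : ZpExtension K p) (hκ : κ.IsAnticyclotomic) (γ : absoluteGaloisGroup K) [Fact (κ.IsTopGenerator γ)]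
    (Sf : Finset (HeightOneSpectrum (𝓞 K)))
    (hSf : ∀ w : HeightOneSpectrum (𝓞 K), w ∈ Sf ↔
      (((W.conductorNorm ℤ : ℤ) : 𝓞 K) ∈ w.asIdeal ∧ ((p : ℕ) : 𝓞 K) ∉ w.asIdeal))
    (hfin : Set.Finite {s : selmerAc (W.baseChange K) p κ vbar (∅ : Set (HeightOneSpectrum (𝓞 K))) | p • s = 0})
    (x : XAc (W.baseChange K) p κ vbar (∅ : Set (HeightOneSpectrum (𝓞 K))) γ) (hx : p • x = 0) : x = 0 := by
  haveI hEK : (W.baseChange K).IsElliptic := inferInstanceAs (W.map (algebraMap ℚ K)).IsElliptic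
  have hS : (∅ : Set (HeightOneSpectrum (𝓞 K))).Finite := Set.finite_empty
  exact xAc_empty_smul_eq_zero_imp_of_facts h411 h41 h42 h32 W hp hK hH hv hvbar hne κ hκ γ Sf hSf
    (XAc.module_finite (W.baseChange K) p κ vbar _ γ hS)
    (UniversalToricDescentAcDualMuZero.isTorsion_of_finite_pTorsion (W.baseChange K) p κ vbar _ γ hS hfin)
    (UniversalToricDescentAcDualMuZero.muInvariant_eq_zero_of_finite_pTorsion (W.baseChange K) p κ vbar _ γ hS hfin) x hx

/-! ## §2 At a NON-SPLIT multiplicative Eisenstein datum, modulo CGLS22 Prop. 14 by name -/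

/-- **(N1)^∅ at every NON-SPLIT multiplicative Eisenstein datum, modulo PUBLISHED facts by name**: `W/ℚ` globally minimal, `2 < p = v v̄`,
`p ‖ N` non-split, `E[p]` reducible, `K` imaginary quadratic with (Heeg) for `N_E`, `κ` anticyclotomic with generator `γ`, `Sf` the places
over `N_E` off `p`: `X_ac(E/K_∞)` has no `p`-torsion, GRANTED Greenberg 2016 Prop. 4.1.1, Greenberg 2006 Props. 4.1, 4.2, 3.2 and
CGLS22 Prop. 14's finiteness clause BY NAME (cotorsion / `μ = 0` of `X^{Sf}` by g4's p626493, descended to the quotient `X^∅`).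
[cite: CastellaGrossiLeeSkinner2022, §1.2 Prop. 14, §1.4 Cor. 1.4.3] [cite: KellerYin2024, Thm. 1.4.1, §1.4 (e), Lemma 5.1.1]
[cite: Greenberg2016Selmer, Prop. 4.1.1 (c)] [cite: Greenberg2006, Props. 3.2, 4.1, 4.2] -/
theorem xAc_empty_smul_eq_zero_imp_of_facts_of_not_split (h411 : prop411_selmer_isAlmostDivisible)
    (h41 : prop41_globalEulerPoincareCorank) (h42 : prop42_localEulerPoincareCorank)
    (h32 : prop32_cohomology_isCofinitelyGenerated) (hfact : prop14_residualCharacterSelmer_finite)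
    (W : WeierstrassCurve ℚ) [W.IsElliptic] [W.IsGloballyMinimal] (hp : 2 < p)
    (hmult : Mult W p) (hns : ¬ W.HasSplitMultiplicativeReductionAtPrime p) (hred : Red W p)
    (hK : IsImaginaryQuadratic K) (hH : SatisfiesHeegnerHypothesis (W.conductorNorm ℤ) K)
    (hsplit : ((Ideal.span {(p : ℤ)}).primesOver (𝓞 K)).ncard = 2)
    {v vbar : HeightOneSpectrum (𝓞 K)} (hv : ((p : ℕ) : 𝓞 K) ∈ v.asIdeal)
    (hvbar : ((p : ℕ) : 𝓞 K) ∈ vbar.asIdeal) (hne : vbar ≠ v)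
    (κ : ZpExtension K p) (hκ : κ.IsAnticyclotomic) (γ : absoluteGaloisGroup K) [Fact (κ.IsTopGenerator γ)]
    (Sf : Finset (HeightOneSpectrum (𝓞 K)))
    (hSf : ∀ w : HeightOneSpectrum (𝓞 K), w ∈ Sf ↔
      (((W.conductorNorm ℤ : ℤ) : 𝓞 K) ∈ w.asIdeal ∧ ((p : ℕ) : 𝓞 K) ∉ w.asIdeal))
    (x : XAc (W.baseChange K) p κ vbar (∅ : Set (HeightOneSpectrum (𝓞 K))) γ) (hx : p • x = 0) : x = 0 := by
  haveI hEK : (W.baseChange K).IsElliptic := inferInstanceAs (W.map (algebraMap ℚ K)).IsElliptic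
  obtain ⟨hfinS, htorS, hμS⟩ := xAc_moduleFinite_isTorsion_muInvariant_of_prop14_of_not_split hfact W K vbar κ γ Sf hp hmult hns
    hred hK hH hsplit hvbar hκ hSf
  haveI := hfinS
  obtain ⟨hfin, htor, hμ, -, -⟩ := XAcImprimitiveLambdaShift.lambdaInvariant_eq_add_zpCorank_of_muInvariant_eq_zero
    (W.baseChange K) p κ vbar γ (Set.empty_subset (↑Sf : Set (HeightOneSpectrum (𝓞 K)))) htorS hμS
  exact xAc_empty_smul_eq_zero_imp_of_facts h411 h41 h42 h32 W hp hK hH hv hvbar hne κ hκ γ Sf hSf hfin htor hμ x hx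

end Summit.BirchSwinnertonDyer.BirchSwinnertonDyer.Theorems.XAcImprimitiveNoPTorsion

end
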